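import Summits.SmoothPoincare4.SmoothPoincare4.Theorems.ConvexBisectionAcyclicBisectionExistsKasOpenBook
import Mathlib.Geometry.Manifold.PartitionOfUnity
import HarnessLib

/-!
# The seam page function, III: gluing two positively proportional page readings
(brick X5-3 (glue part) of clause (ii) "the seam page function `F : ∂X₁ → ℂ`" of the registered stub
`stub_T3_dualPresentation` (T3), line `modp-braid-orbits`, crux `ConvexBisection.AcyclicBisectionExists`,
item stmt-SmoothPoincare4-10508; wave 5, lead c5)

Pure differential topology on a `3`-manifold `N` (charted on `ℝ³`, Hausdorff, σ-compact).  Two partial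
"page readings" `F₁, F₂ : N → ℂ`, smooth on open sets `U₁, U₂` covering `N` and POSITIVELY
PROPORTIONAL on the overlap (`F₂ y = c F₁ y`, `c > 0`), glue to ONE smooth `F : N → ℂ`, positively
proportional to `F₁` on `U₁` and to `F₂` on `U₂`, by a smooth partition of unity `ρ₁ + ρ₂ = 1`
subordinate to `(U₁, U₂)` (`SmoothPartitionOfUnity.exists_isSubordinate`): **`F := ρ₁ F₁ + ρ₂ F₂`**
(`exists_glue_pageReadings`).  The only non-formal point is the derivative clause (ii-e) of T3,
`∃ v, Im(conj(F y) · dF_y v) ≠ 0`: it descends from `F₁` to `F` at points of `U₁` where `F₁ ≠ 0` because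
`F = m F₁` near such a point with `m > 0` REAL, so `arg F = arg F₁` there and the angular
differentials of `F/‖F‖` and `F₁/‖F₁‖` (V1's `argProj`, `angularDeriv_argProj`) coincide
(`exists_im_ne_zero_of_posMul`, through a smooth bump `χ` making `χ F₁` globally smooth).

Everything here is proved; no named facts, no `def`.

## References
* J. M. Lee, *Introduction to Smooth Manifolds* (2013), Thm. 2.23 (partitions of unity). [LeeSmoothManifolds2013]
-/

noncomputable section

-- the prescribed namespace `Summit.<P>.<Sub>.…` duplicates `SmoothPoincare4` (P = Sub)
set_option linter.dupNamespace false

open scoped Manifold ContDiff Topology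

namespace Summit.SmoothPoincare4.SmoothPoincare4.Theorems.AcyclicBisectionExists.ModpBraidOrbits

open Set Function Filter
open Literature.Topology.FourManifolds Literature.Geometry.Symplectic

universe u

section ArgProj

variable {N : Type u}

/-- **The argument map of a positive multiple**: if `F x = c F₁ x` with `c > 0` and `F₁ x ≠ 0`, then
`F x/‖F x‖ = F₁ x/‖F₁ x‖` in `ℝ²`. [folklore] -/
theorem coe_argProj_eq_of_posMul {F F₁ : N → ℂ} {x : N} {c : ℝ} (hc : 0 < c) (h0 : F₁ x ≠ 0)
    (hF : F x = c * F₁ x) :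
    ((argProj F x : Metric.sphere (0 : EuclideanSpace ℝ (Fin 2)) 1) : EuclideanSpace ℝ (Fin 2)) =
      ((argProj F₁ x : Metric.sphere (0 : EuclideanSpace ℝ (Fin 2)) 1) : EuclideanSpace ℝ (Fin 2)) := by
  rw [coe_argProj_of_eq_mul hc h0 hF, coe_argProj h0, LefschetzBase.norm_vec2]

end ArgProj

section Glue

variable {N : Type u} [TopologicalSpace N] [ChartedSpace (EuclideanSpace ℝ (Fin 3)) N]
  [IsManifold (𝓡 3) ∞ N] [T2Space N]

/-- **The derivative clause descends along a positive real factor.**  `F` smooth, `F₁` smooth on an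
open `U₁ ∋ y`, `F = c(x) F₁` with `c(x) > 0` on `U₁`, `F₁ y ≠ 0` and `Im(conj(F₁ y) dF₁(v)) ≠ 0` for some
`v` ⟹ `Im(conj(F y) dF(v)) ≠ 0` for some `v` (same `arg`, same angular differential). [folklore] -/
theorem exists_im_ne_zero_of_posMul {F F₁ : N → ℂ} {U₁ : Set N} {y : N}
    (hF : ContMDiff (𝓡 3) 𝓘(ℝ, ℂ) ∞ F) (hU₁ : IsOpen U₁) (hy : y ∈ U₁)
    (hF₁ : ContMDiffOn (𝓡 3) 𝓘(ℝ, ℂ) ∞ F₁ U₁)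
    (hprop : ∀ x ∈ U₁, ∃ c : ℝ, 0 < c ∧ F x = c * F₁ x) (h0 : F₁ y ≠ 0)
    (hv : ∃ v : EuclideanSpace ℝ (Fin 3),
      ((starRingEnd ℂ) (F₁ y) * @id ℂ (mfderiv (𝓡 3) 𝓘(ℝ, ℂ) F₁ y v)).im ≠ 0) :
    ∃ v : EuclideanSpace ℝ (Fin 3),
      ((starRingEnd ℂ) (F y) * @id ℂ (mfderiv (𝓡 3) 𝓘(ℝ, ℂ) F y v)).im ≠ 0 := by
  haveI : FiniteDimensional ℝ (EuclideanSpace ℝ (Fin 3)) := inferInstance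
  -- a smooth bump at `y` supported in `U₁`, and the globally smooth `F₁' = χ F₁`
  obtain ⟨χ, -, hχ⟩ := (SmoothBumpFunction.nhds_basis_tsupport (I := 𝓡 3) y).mem_iff.1
    (hU₁.mem_nhds hy)
  set F₁' : N → ℂ := fun x => χ x • F₁ x with hF₁'
  have hF₁'s : ContMDiff (𝓡 3) 𝓘(ℝ, ℂ) ∞ F₁' :=
    contMDiff_of_tsupport fun x hx =>
      χ.contMDiffAt.smul (hF₁.contMDiffAt (hU₁.mem_nhds (hχ (tsupport_smul_subset_left _ _ hx))))
  have heq : F₁' =ᶠ[𝓝 y] F₁ := χ.eventuallyEq_one.mono fun x hx => by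
    simp only [hF₁']
    rw [hx, Pi.one_apply, one_smul]
  have hy' : F₁' y = F₁ y := heq.self_of_nhds
  have hd' : mfderiv (𝓡 3) 𝓘(ℝ, ℂ) F₁' y = mfderiv (𝓡 3) 𝓘(ℝ, ℂ) F₁ y := heq.mfderiv_eq
  -- the angular differential of `F₁'/‖F₁'‖` at `y` is non-zero
  obtain ⟨v, hv⟩ := hv
  have h0' : F₁' y ≠ 0 := by rwa [hy']
  have h1 : angularDeriv (argProj F₁') y v ≠ 0 := by
    rw [angularDeriv_argProj hF₁'s h0' v]
    have hd'' : @id ℂ (mfderiv (𝓡 3) 𝓘(ℝ, ℂ) F₁' y v) = @id ℂ (mfderiv (𝓡 3) 𝓘(ℝ, ℂ) F₁ y v) := by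
      rw [hd']
      rfl
    rw [hd'', hy']
    exact mul_ne_zero (inv_ne_zero (pow_ne_zero 2 (norm_ne_zero_iff.2 h0))) hv
  -- `F/‖F‖ = F₁'/‖F₁'‖` near `y`
  have hF₁c : ContinuousAt F₁ y := (hF₁.contMDiffAt (hU₁.mem_nhds hy)).continuousAt
  have hne : ∀ᶠ x in 𝓝 y, F₁ x ≠ 0 := hF₁c.eventually_ne h0
  have hge : (fun x => ((argProj F x : Metric.sphere (0 : EuclideanSpace ℝ (Fin 2)) 1) :
      EuclideanSpace ℝ (Fin 2))) =ᶠ[𝓝 y]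
      fun x => ((argProj F₁' x : Metric.sphere (0 : EuclideanSpace ℝ (Fin 2)) 1) :
        EuclideanSpace ℝ (Fin 2)) := by
    filter_upwards [hne, heq, hU₁.mem_nhds hy] with x hx hx' hxU
    obtain ⟨c, hc, hcx⟩ := hprop x hxU
    rw [coe_argProj_eq_of_posMul hc hx hcx, coe_argProj hx, coe_argProj (show F₁' x ≠ 0 by rwa [hx']),
      hx']
  have hpt : argProj F y = argProj F₁' y := Subtype.ext hge.self_of_nhds
  have h2 : angularDeriv (argProj F) y = angularDeriv (argProj F₁') y := by
    ext w
    rw [angularDeriv_apply, angularDeriv_apply, hpt, hge.mfderiv_eq]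
  -- conclude for `F`
  obtain ⟨c, hc, hcy⟩ := hprop y hy
  have hFy : F y ≠ 0 := by rw [hcy]; exact mul_ne_zero (Complex.ofReal_ne_zero.2 hc.ne') h0
  refine ⟨v, fun him => h1 ?_⟩
  rw [← h2, angularDeriv_argProj hF hFy v, him, mul_zero]

variable [SigmaCompactSpace N]

/-- **GLUING TWO POSITIVELY PROPORTIONAL PAGE READINGS.**  `U₁ ∪ U₂ = N` open, `Fᵢ` smooth on `Uᵢ`,
`F₂ = c F₁` with `c > 0` pointwise on `U₁ ∩ U₂` ⟹ there is a smooth `F : N → ℂ`, a positive multiple of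
`F₁` on `U₁` and of `F₂` on `U₂`, whose derivative clause `∃ v, Im(conj F · dF v) ≠ 0` holds wherever it
holds for `F₁` (on `U₁`, off `F₁ = 0`) or for `F₂` (on `U₂`, off `F₂ = 0`).  Construction:
`F = ρ₁ F₁ + ρ₂ F₂` for a smooth partition of unity subordinate to `(U₁, U₂)`.
[cite: LeeSmoothManifolds2013, Thm. 2.23] -/
theorem exists_glue_pageReadings {U₁ U₂ : Set N} (hU₁ : IsOpen U₁) (hU₂ : IsOpen U₂)
    (hU : U₁ ∪ U₂ = univ) {F₁ F₂ : N → ℂ} (hF₁ : ContMDiffOn (𝓡 3) 𝓘(ℝ, ℂ) ∞ F₁ U₁)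
    (hF₂ : ContMDiffOn (𝓡 3) 𝓘(ℝ, ℂ) ∞ F₂ U₂)
    (hagree : ∀ y ∈ U₁ ∩ U₂, ∃ c : ℝ, 0 < c ∧ F₂ y = c * F₁ y) :
    ∃ F : N → ℂ, ContMDiff (𝓡 3) 𝓘(ℝ, ℂ) ∞ F ∧
      (∀ y ∈ U₁, ∃ c : ℝ, 0 < c ∧ F y = c * F₁ y) ∧
      (∀ y ∈ U₂, ∃ c : ℝ, 0 < c ∧ F y = c * F₂ y) ∧
      (∀ y ∈ U₁, F₁ y ≠ 0 →
        (∃ v : EuclideanSpace ℝ (Fin 3),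
          ((starRingEnd ℂ) (F₁ y) * @id ℂ (mfderiv (𝓡 3) 𝓘(ℝ, ℂ) F₁ y v)).im ≠ 0) →
        ∃ v : EuclideanSpace ℝ (Fin 3),
          ((starRingEnd ℂ) (F y) * @id ℂ (mfderiv (𝓡 3) 𝓘(ℝ, ℂ) F y v)).im ≠ 0) ∧
      (∀ y ∈ U₂, F₂ y ≠ 0 →
        (∃ v : EuclideanSpace ℝ (Fin 3),
          ((starRingEnd ℂ) (F₂ y) * @id ℂ (mfderiv (𝓡 3) 𝓘(ℝ, ℂ) F₂ y v)).im ≠ 0) →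
        ∃ v : EuclideanSpace ℝ (Fin 3),
          ((starRingEnd ℂ) (F y) * @id ℂ (mfderiv (𝓡 3) 𝓘(ℝ, ℂ) F y v)).im ≠ 0) := by
  classical
  haveI : FiniteDimensional ℝ (EuclideanSpace ℝ (Fin 3)) := inferInstance
  -- a smooth partition of unity subordinate to `(U₁, U₂)`
  set U : Bool → Set N := fun b => cond b U₁ U₂ with hUdef
  have hUo : ∀ b, IsOpen (U b) := fun b => by cases b <;> simpa [hUdef]
  have hUc : (univ : Set N) ⊆ ⋃ b, U b := by
    intro x _
    have hx : x ∈ U₁ ∪ U₂ := by rw [hU]; exact mem_univ x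
    rcases hx with hx | hx
    · exact mem_iUnion.2 ⟨true, hx⟩
    · exact mem_iUnion.2 ⟨false, hx⟩
  obtain ⟨ρ, hρ⟩ := SmoothPartitionOfUnity.exists_isSubordinate (𝓡 3) isClosed_univ U hUo hUc
  have hsum : ∀ x, ρ true x + ρ false x = 1 := fun x => by
    have h := ρ.sum_eq_one (mem_univ x)
    rwa [finsum_eq_sum_of_fintype, Fintype.sum_bool] at h
  have hzero₂ : ∀ x, x ∉ U₂ → ρ false x = 0 := fun x hx =>
    image_eq_zero_of_notMem_tsupport fun h => hx (hρ false h)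
  have hzero₁ : ∀ x, x ∉ U₁ → ρ true x = 0 := fun x hx =>
    image_eq_zero_of_notMem_tsupport fun h => hx (hρ true h)
  -- the glued function
  set F : N → ℂ := fun x => ρ true x • F₁ x + ρ false x • F₂ x with hFdef
  have hFs : ContMDiff (𝓡 3) 𝓘(ℝ, ℂ) ∞ F :=
    (ρ.contMDiff_smul fun x hx => hF₁.contMDiffAt (hU₁.mem_nhds (hρ true hx))).add
      (ρ.contMDiff_smul fun x hx => hF₂.contMDiffAt (hU₂.mem_nhds (hρ false hx)))
  -- positive proportionality
  have hP₁ : ∀ y ∈ U₁, ∃ c : ℝ, 0 < c ∧ F y = c * F₁ y := by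
    intro y hy
    by_cases hy₂ : y ∈ U₂
    · obtain ⟨c, hc, hcy⟩ := hagree y ⟨hy, hy₂⟩
      refine ⟨ρ true y + ρ false y * c, ?_, ?_⟩
      · have h1 := ρ.nonneg true y
        have h2 := ρ.nonneg false y
        have hs := hsum y
        nlinarith [min_le_left (1 : ℝ) c, min_le_right (1 : ℝ) c, lt_min one_pos hc,
          mul_nonneg h1 (sub_nonneg.2 (min_le_left (1 : ℝ) c)),
          mul_nonneg h2 (sub_nonneg.2 (min_le_right (1 : ℝ) c))]
      · show ρ true y • F₁ y + ρ false y • F₂ y = _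
        rw [hcy, Complex.real_smul, Complex.real_smul]
        push_cast
        ring
    · refine ⟨1, one_pos, ?_⟩
      show ρ true y • F₁ y + ρ false y • F₂ y = _
      have h1 : ρ true y = 1 := by have := hsum y; rw [hzero₂ y hy₂] at this; linarith
      rw [hzero₂ y hy₂, h1, one_smul, zero_smul, add_zero, Complex.ofReal_one, one_mul]
  have hP₂ : ∀ y ∈ U₂, ∃ c : ℝ, 0 < c ∧ F y = c * F₂ y := by
    intro y hy
    by_cases hy₁ : y ∈ U₁
    · obtain ⟨c, hc, hcy⟩ := hagree y ⟨hy₁, hy⟩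
      have h0 : (c : ℂ) ≠ 0 := Complex.ofReal_ne_zero.2 hc.ne'
      have hF₁y : F₁ y = (c : ℂ)⁻¹ * F₂ y := by rw [hcy, ← mul_assoc, inv_mul_cancel₀ h0, one_mul]
      refine ⟨ρ true y * c⁻¹ + ρ false y, ?_, ?_⟩
      · have h1 := ρ.nonneg true y
        have h2 := ρ.nonneg false y
        have hs := hsum y
        have hc' : 0 < c⁻¹ := inv_pos.2 hc
        nlinarith [min_le_left (1 : ℝ) c⁻¹, min_le_right (1 : ℝ) c⁻¹, lt_min one_pos hc',
          mul_nonneg h2 (sub_nonneg.2 (min_le_left (1 : ℝ) c⁻¹)),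
          mul_nonneg h1 (sub_nonneg.2 (min_le_right (1 : ℝ) c⁻¹))]
      · show ρ true y • F₁ y + ρ false y • F₂ y = _
        rw [hF₁y, Complex.real_smul, Complex.real_smul]
        push_cast
        ring
    · refine ⟨1, one_pos, ?_⟩
      show ρ true y • F₁ y + ρ false y • F₂ y = _
      have h1 : ρ false y = 1 := by have := hsum y; rw [hzero₁ y hy₁] at this; linarith
      rw [hzero₁ y hy₁, h1, one_smul, zero_smul, zero_add, Complex.ofReal_one, one_mul]
  refine ⟨F, hFs, hP₁, hP₂, ?_, ?_⟩
  · intro y hy h0 hv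
    exact exists_im_ne_zero_of_posMul hFs hU₁ hy hF₁ hP₁ h0 hv
  · intro y hy h0 hv
    exact exists_im_ne_zero_of_posMul hFs hU₂ hy hF₂ hP₂ h0 hv

end Glue

/-! ### Registered helper -/

/-- **Registered helper `helper_exists_glue_pageReadings` (sub-goal of `stub_T3_dualPresentation`, T3
clause (ii), brick X5-3 (glue part), wave 5, lead c5): gluing two positively proportional page readings
on a `3`-manifold into one smooth page function with the derivative clause.**
[cite: LeeSmoothManifolds2013, Thm. 2.23] -/
theorem helper_exists_glue_pageReadings : ∀ {N : Type} [TopologicalSpace N] [ChartedSpace (EuclideanSpace ℝ (Fin 3)) N] [IsManifold (𝓡 3) ∞ N] [T2Space N] [SigmaCompactSpace N] {U₁ U₂ : Set N}, IsOpen U₁ → IsOpen U₂ → U₁ ∪ U₂ = Set.univ → ∀ {F₁ F₂ : N → ℂ}, ContMDiffOn (𝓡 3) 𝓘(ℝ, ℂ) ∞ F₁ U₁ → ContMDiffOn (𝓡 3) 𝓘(ℝ, ℂ) ∞ F₂ U₂ → (∀ y ∈ U₁ ∩ U₂, ∃ c : ℝ, 0 < c ∧ F₂ y = c * F₁ y)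 → ∃ F : N → ℂ, ContMDiff (𝓡 3) 𝓘(ℝ, ℂ) ∞ F ∧ (∀ y ∈ U₁, ∃ c : ℝ, 0 < c ∧ F y = c * F₁ y) ∧ (∀ y ∈ U₂, ∃ c : ℝ, 0 < c ∧ F y = c * F₂ y) ∧ (∀ y ∈ U₁, F₁ y ≠ 0 → (∃ v : EuclideanSpace ℝ (Fin 3), ((starRingEnd ℂ) (F₁ y) * @id ℂ (mfderiv (𝓡 3) 𝓘(ℝ, ℂ) F₁ y v)).im ≠ 0) → ∃ v : EuclideanSpace ℝ (Fin 3), ((starRingEnd ℂ) (F y) * @id ℂ (mfderiv (𝓡 3) 𝓘(ℝ, ℂ) F y v)).im ≠ 0) ∧ (∀ y ∈ U₂, F₂ y ≠ 0 → (∃ v : EuclideanSpace ℝ (Fin 3), ((starRingEnd ℂ) (F₂ y) * @id ℂ (mfderiv (𝓡 3) 𝓘(ℝ, ℂ) F₂ y v)).im ≠ 0) → ∃ v : EuclideanSpace ℝ (Fin 3), ((starRingEnd ℂ) (F y) * @id ℂ (mfderiv (𝓡 3) 𝓘(ℝ, ℂ) F y v)).im ≠ 0) :=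
  fun hU₁ hU₂ hU _ _ hF₁ hF₂ hagree => exists_glue_pageReadings hU₁ hU₂ hU hF₁ hF₂ hagree

end Summit.SmoothPoincare4.SmoothPoincare4.Theorems.AcyclicBisectionExists.ModpBraidOrbits

end
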